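import Summits.Ventures.PercRepro.C041ZonePortDefs

/-!
# Loose zone port problems — the single-layer object of an O-cube (p6, gen 25; C-041.md §5, §9)

A LAYER `O ∪ X` of mine-3's O-cube (C-041.md §5 (b)) is a zone port problem whose partially opened zones are NOT
internally red-connected — exactly the hypothesis `hzconn` of `ZonePort.Problem` (the rc hypothesis behind THE KEY
FACT of THEOREM R).  `Loose V E` is `Problem V E` without `hzconn`: the same graph, root set, zones (pairwise
disjoint, disjoint from the root), terminal edges, switch flags, and the SAME predicates — admissibility, the deleted
sets `A_t`, avoiding reachability from the root set, `X_t`, `Good_t`, the weight `3·[Good₁] + 3·[Good₂] − 2` and the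
sums `Φ∨`, `Φ∧` — so that a vertex of a loose zone that is not reached is simply no endpoint (the paper's «`u′` is
never an endpoint» in the blue layer of LEMMA O₂).  `Problem.toLoose` forgets `hzconn`; the weight sums agree
definitionally (`phiOr_toLoose`, `phiAnd_toLoose`).  This is the object on which the cut-vertex decomposition
(`C041CutSplit*`, the graph-side instance of LEMMA G) is stated, so that it applies to every layer of an O-cube.
Nothing about THE LEMMA (`0 ≤ Φ`) is claimed for loose problems — it is false for them in general (C-041.md §3
REMARK (2): the 6-core's `F(O) = −6`).
-/

namespace PercRepro

namespace ZonePort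

open Finset

/-- A loose zone port problem: a `Problem` without the internal-connectivity hypothesis on the zones. -/
structure Loose (V E : Type*) where
  /-- the graph -/
  adj : V → V → Prop
  /-- the graph is undirected -/
  symm : ∀ x y, adj x y → adj y x
  /-- the root set -/
  root : Finset V
  /-- the zones (the ports) -/
  Z : Finset (Finset V)
  /-- the zones are pairwise disjoint -/
  hdisj : ∀ C ∈ Z, ∀ D ∈ Z, C ≠ D → ∀ v ∈ C, v ∉ D
  /-- the root set meets no zone -/
  hroot : ∀ C ∈ Z, ∀ v ∈ C, v ∉ root
  /-- the vertex carrying a terminal edge -/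
  tv : E → V
  /-- the side of a terminal edge: `false` = 1-edge, `true` = 2-edge -/
  ts : E → Bool
  /-- the zone of the vertex carrying a terminal edge -/
  tz : E → Finset V
  /-- the vertex lies in its zone -/
  htv : ∀ e, tv e ∈ tz e
  /-- the zone is switchable (its terminal edges may be blue) -/
  sw : Finset V → Bool
  /-- every zone carries a terminal edge -/
  hk : ∀ C ∈ Z, ∃ e, tz e = C

namespace Loose

variable {V E : Type*}

/-- The terminal edges at the ports. -/
abbrev Term (L : Loose V E) : Type _ := {e : E // L.tz e ∈ L.Z}

/-- The port vertices: the union of the zones. -/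
def PV (L : Loose V E) : Set V := {v | ∃ C ∈ L.Z, v ∈ C}

/-- Admissibility: every edge of a non-switchable zone is red and no zone carries a blue 1-edge together with a
blue 2-edge. -/
def Adm (L : Loose V E) (x : L.Term → Bool) : Prop :=
  (∀ e : L.Term, L.sw (L.tz e.1) = false → x e = true) ∧
  (∀ e f : L.Term, L.tz e.1 = L.tz f.1 → L.ts e.1 = false → L.ts f.1 = true → x e = true ∨ x f = true)

/-- The vertices deleted on side `1`: the zones with a blue 1-edge. -/
def A₁ (L : Loose V E) (x : L.Term → Bool) : Set V :=
  {v | ∃ e : L.Term, L.ts e.1 = false ∧ x e = false ∧ v ∈ L.tz e.1}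

/-- The vertices deleted on side `2`: the zones with a blue 2-edge. -/
def A₂ (L : Loose V E) (x : L.Term → Bool) : Set V :=
  {v | ∃ e : L.Term, L.ts e.1 = true ∧ x e = false ∧ v ∈ L.tz e.1}

/-- `L.Reach A u v`: a path from `u` to `v` none of whose vertices lies in `A`. -/
def Reach (L : Loose V E) (A : Set V) (u v : V) : Prop :=
  u ∉ A ∧ Relation.ReflTransGen (fun a b => L.adj a b ∧ b ∉ A) u v

/-- `L.RReach A v`: `v` is reached from the root set avoiding `A`. -/
def RReach (L : Loose V E) (A : Set V) (v : V) : Prop := ∃ u ∈ L.root, L.Reach A u v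

/-- Some red 1-edge. -/
def X₁ (L : Loose V E) (x : L.Term → Bool) : Prop := ∃ e : L.Term, L.ts e.1 = false ∧ x e = true

/-- Some red 2-edge. -/
def X₂ (L : Loose V E) (x : L.Term → Bool) : Prop := ∃ e : L.Term, L.ts e.1 = true ∧ x e = true

/-- `Good₁`: a red 2-edge is carried by a vertex reached from the root set avoiding the zones deleted on side
`1`. -/
def Good₁ (L : Loose V E) (x : L.Term → Bool) : Prop :=
  ∃ e : L.Term, L.ts e.1 = true ∧ x e = true ∧ L.RReach (L.A₁ x) (L.tv e.1)

/-- `Good₂`: a red 1-edge is carried by a vertex reached from the root set avoiding the zones deleted on side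
`2`. -/
def Good₂ (L : Loose V E) (x : L.Term → Bool) : Prop :=
  ∃ e : L.Term, L.ts e.1 = false ∧ x e = true ∧ L.RReach (L.A₂ x) (L.tv e.1)

open Classical in
/-- The weight of a pattern: `3·[Good₁] + 3·[Good₂] − 2`. -/
noncomputable def weight (L : Loose V E) (x : L.Term → Bool) : ℤ :=
  (if L.Good₁ x then 3 else 0) + (if L.Good₂ x then 3 else 0) - 2

/-- **S3**: `Good₁` gives a red 2-edge. -/
theorem good₁_X₂ {L : Loose V E} {x : L.Term → Bool} (h : L.Good₁ x) : L.X₂ x := by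
  obtain ⟨e, he, hx, _⟩ := h
  exact ⟨e, he, hx⟩

/-- **S3**: `Good₂` gives a red 1-edge. -/
theorem good₂_X₁ {L : Loose V E} {x : L.Term → Bool} (h : L.Good₂ x) : L.X₁ x := by
  obtain ⟨e, he, hx, _⟩ := h
  exact ⟨e, he, hx⟩

/-- The deleted vertices are port vertices. -/
theorem A₁_subset (L : Loose V E) (x : L.Term → Bool) : L.A₁ x ⊆ L.PV := by
  rintro v ⟨e, _, _, hv⟩
  exact ⟨L.tz e.1, e.2, hv⟩

/-- The deleted vertices are port vertices. -/
theorem A₂_subset (L : Loose V E) (x : L.Term → Bool) : L.A₂ x ⊆ L.PV := by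
  rintro v ⟨e, _, _, hv⟩
  exact ⟨L.tz e.1, e.2, hv⟩

/-- The vertex of a term is a port vertex. -/
theorem tv_mem_PV (L : Loose V E) (e : L.Term) : L.tv e.1 ∈ L.PV := ⟨L.tz e.1, e.2, L.htv e.1⟩

section Sums

variable [Fintype E] [DecidableEq E] [DecidableEq V]

open Classical in
/-- `Φ∨ L`: the weight sum over the admissible patterns with a red terminal edge (`X₁ ∨ X₂`). -/
noncomputable def phiOr (L : Loose V E) : ℤ :=
  ∑ x : L.Term → Bool, if L.Adm x ∧ (L.X₁ x ∨ L.X₂ x) then L.weight x else 0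

open Classical in
/-- `Φ∧ L`: the weight sum over the admissible patterns with a red 1-edge and a red 2-edge (`X₁ ∧ X₂`). -/
noncomputable def phiAnd (L : Loose V E) : ℤ :=
  ∑ x : L.Term → Bool, if L.Adm x ∧ (L.X₁ x ∧ L.X₂ x) then L.weight x else 0

end Sums

end Loose

namespace Problem

variable {V E : Type*}

/-- Forgetting the internal connectivity of the zones. -/
def toLoose (P : Problem V E) : Loose V E where
  adj := P.adj
  symm := P.symm
  root := P.root
  Z := P.Z
  hdisj := P.hdisj
  hroot := P.hroot
  tv := P.tv
  ts := P.ts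
  tz := P.tz
  htv := P.htv
  sw := P.sw
  hk := P.hk

variable [Fintype E] [DecidableEq E] [DecidableEq V]

/-- The weight sum `Φ∨` of a problem is that of its loose version. -/
theorem phiOr_toLoose (P : Problem V E) : P.toLoose.phiOr = P.phiOr := rfl

/-- The weight sum `Φ∧` of a problem is that of its loose version. -/
theorem phiAnd_toLoose (P : Problem V E) : P.toLoose.phiAnd = P.phiAnd := rfl

end Problem

end ZonePort

end PercRepro
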